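import Summits.CriticalPhenomena.PercolationContinuityZ3.Theorems.PercNearOneGluingNoHeavyLowerTailTformChampionPairStability
import Summits.CriticalPhenomena.PercolationContinuityZ3.Theorems.PercNearOneGluingNoHeavyLowerTailTformGluedStarPackingRef
import HarnessLib

/-!
# `NoHeavyLowerTail` (stmt-CriticalPhenomena-4575) — the gluing step from a general STARWISE-REFERENCE certificate (REF)

Support file (prover `prim-hp-5`, hull-port cell, T-form calculus, gen 7; `--supports stmt-CriticalPhenomena-4575`).  No definitions,
no named facts, no sorries.  Setting of the core gluing step (`Theorems.noHeavyLowerTail_of_coreGluedChampion`): champion `q`, fallback `c`,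
light non-relay `B` (`2 ≤ |B|`), the set-induction hypothesis, a member `y` (with a positive pair), `u` = `w` without the pairs at `y`,
`B' = B ∖ y`, the star event `σ_S` of `y` (exactly the gates `S` open), `G_x` = "`x` light in `w/B`".  A STARWISE REFERENCE is a relay
`r S` for every star `S` which is admissible for the glued star `B' ∪ S` in `u` for one of two checkable reasons: `r S` is a champion of `u`
(induction hypothesis / stability), or `r S` is no heavier in `u` than some member of `B' ∪ S` (unguarded stability).  The glued star packing
with starwise references (`Theorems.gluedSet_lsp_of_starwise`) then gives LSP(w, q, c, B) as soon as `Σ_S μ(G_{r S} ∩ σ_S) ≤ μ(G_q)`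
— the certificate REF of the seat memo (OBSERVER-SET.md §18–21; 0 violations in every census so far, while the coarser two-event form REF3
has an exact failure, ttrl2 2026-08-20).

* `gluedSet_lsp_of_starwiseRefs` — LSP(w, q, c, B) from a starwise reference;
* `noHeavyLowerTail_of_refCertificate` — the crux from a starwise reference at every CORE gluing instance.
-/

noncomputable section

namespace Summit.CriticalPhenomena.PercolationContinuityZ3.Theorems

open MeasureTheory Set Literature.Probability.LatticeModels Literature.Probability.Percolation
open scoped Classical BigOperators

variable {n : ℕ}

open CutObserver KNPreFKG in
/-- **The gluing step from a starwise reference (REF).**  With the set-induction hypothesis, a member `y ∈ B` with a positive pair, and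
for every star `S` of `y` a relay `r S` which is either a champion of `u` or no heavier in `u` than some member of `(B ∖ y) ∪ S`:
if `Σ_S μ(G_{r S} ∩ σ_S) ≤ μ(G_q)` then LSP(w, q, c, B). [cite: KozmaNitzan2024, Lemma 5 and Thm. 4 (pp. 13–14)] -/
theorem gluedSet_lsp_of_starwiseRefs (w : Sym2 (Fin n) → unitInterval) (A B : Finset (Fin n)) (y q c : Fin n) (r : Finset (Fin n) → Fin n)
    (j : ℕ)
    (ih : ∀ (n' : ℕ) (w' : Sym2 (Fin n') → unitInterval) (A' B' : Finset (Fin n')) (q' c' : Fin n') (j' : ℕ),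
      (Finset.univ.filter fun e : Sym2 (Fin n') => w' e ≠ 0).card < (Finset.univ.filter fun e : Sym2 (Fin n) => w e ≠ 0).card →
      q' ∈ A' → c' ∈ A' → B'.Nonempty → (∀ m ∈ B', m ∉ A') →
      (∀ a ∈ A', (prodBernoulli w').real {ω : BondConfig (Fin n') | (A'.filter fun x => ω ∈ openConn a x).card ≤ j'} ≤
        (prodBernoulli w').real {ω : BondConfig (Fin n') | (A'.filter fun x => ω ∈ openConn q' x).card ≤ j'}) →
      (prodBernoulli w').real {ω : BondConfig (Fin n') | (∀ m ∈ B', ω ∉ openConn q' m) ∧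
          1 ≤ (A'.filter fun z => ∃ m ∈ B', ω ∈ openConn m z).card ∧ (A'.filter fun z => ∃ m ∈ B', ω ∈ openConn m z).card ≤ j'} +
        (prodBernoulli w').real {ω : BondConfig (Fin n') | ¬ 1 ≤ (A'.filter fun z => ∃ m ∈ B', ω ∈ openConn m z).card ∧
          (A'.filter fun z => ω ∈ openConn c' z).card ≤ j'} ≤
      (prodBernoulli w').real {ω : BondConfig (Fin n') | (∀ m ∈ B', ω ∉ openConn q' m) ∧ (A'.filter fun z => ω ∈ openConn q' z).card ≤ j'})
    (hqA : q ∈ A) (hcA : c ∈ A) (hBA : ∀ m ∈ B, m ∉ A) (hyB : y ∈ B) (hB2 : 2 ≤ B.card) (hy : ∃ v, v ≠ y ∧ w s(y, v) ≠ 0)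
    (hrA : ∀ S, r S ∈ A)
    (hadm : ∀ S : Finset (Fin n), (∀ v ∈ S, v ≠ y ∧ w s(y, v) ≠ 0) →
      (∀ a ∈ A, (prodBernoulli fun e => if e ∈ {e : Sym2 (Fin n) | y ∉ e} then w e else 0).real
          {ξ : BondConfig (Fin n) | (A.filter fun z => ξ ∈ openConn a z).card ≤ j} ≤
        (prodBernoulli fun e => if e ∈ {e : Sym2 (Fin n) | y ∉ e} then w e else 0).real
          {ξ : BondConfig (Fin n) | (A.filter fun z => ξ ∈ openConn (r S) z).card ≤ j}) ∨
      (∃ m ∈ B.erase y ∪ S, m ≠ r S ∧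
        (prodBernoulli fun e => if e ∈ {e : Sym2 (Fin n) | y ∉ e} then w e else 0).real
            {ξ : BondConfig (Fin n) | (A.filter fun z => ξ ∈ openConn m z).card ≤ j} ≤
          (prodBernoulli fun e => if e ∈ {e : Sym2 (Fin n) | y ∉ e} then w e else 0).real
            {ξ : BondConfig (Fin n) | (A.filter fun z => ξ ∈ openConn (r S) z).card ≤ j}))
    (hsum : ∑ S ∈ (Finset.univ.filter fun v => v ≠ y ∧ w s(y, v) ≠ 0).powerset, (prodBernoulli w).real ({ω : BondConfig (Fin n) |
        ((∃ m ∈ B, ω ∈ openConn (r S) m) → (A.filter fun z => ∃ m ∈ B, ω ∈ openConn m z).card ≤ j) ∧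
          ((∀ m ∈ B, ω ∉ openConn (r S) m) → (A.filter fun z => ω ∈ openConn (r S) z).card ≤ j)} ∩ starEvent y ↑S) ≤
      (prodBernoulli w).real {ω : BondConfig (Fin n) |
        ((∃ m ∈ B, ω ∈ openConn q m) → (A.filter fun z => ∃ m ∈ B, ω ∈ openConn m z).card ≤ j) ∧
          ((∀ m ∈ B, ω ∉ openConn q m) → (A.filter fun z => ω ∈ openConn q z).card ≤ j)}) :
    (prodBernoulli w).real {ω : BondConfig (Fin n) | (∀ m ∈ B, ω ∉ openConn q m) ∧
        1 ≤ (A.filter fun z => ∃ m ∈ B, ω ∈ openConn m z).card ∧ (A.filter fun z => ∃ m ∈ B, ω ∈ openConn m z).card ≤ j} +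
      (prodBernoulli w).real {ω : BondConfig (Fin n) | ¬ 1 ≤ (A.filter fun z => ∃ m ∈ B, ω ∈ openConn m z).card ∧
        (A.filter fun z => ω ∈ openConn c z).card ≤ j} ≤
      (prodBernoulli w).real {ω : BondConfig (Fin n) | (∀ m ∈ B, ω ∉ openConn q m) ∧ (A.filter fun z => ω ∈ openConn q z).card ≤ j} := by
  haveI : IsProbabilityMeasure (prodBernoulli w) := inferInstance
  have hyA : y ∉ A := hBA y hyB
  set B' : Finset (Fin n) := B.erase y with hB'
  have hyB' : y ∉ B' := Finset.notMem_erase y B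
  have hBeq : insert y B' = B := Finset.insert_erase hyB
  have hB'ne : B'.Nonempty := by
    rw [← Finset.card_pos, hB', Finset.card_erase_of_mem hyB]; omega
  set u : Sym2 (Fin n) → unitInterval := fun e => if e ∈ {e : Sym2 (Fin n) | y ∉ e} then w e else 0 with hu
  obtain ⟨v₀, hv₀y, hv₀⟩ := hy
  have hlt : (Finset.univ.filter fun e : Sym2 (Fin n) => u e ≠ 0).card <
      (Finset.univ.filter fun e : Sym2 (Fin n) => w e ≠ 0).card := by
    refine Finset.card_lt_card ⟨fun e he => ?_, fun hsub => ?_⟩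
    · rw [Finset.mem_filter] at he ⊢
      refine ⟨he.1, fun hwe => he.2 ?_⟩
      simp only [hu, mem_setOf_eq]
      split_ifs <;> simp [hwe]
    · have hmem : s(y, v₀) ∈ (Finset.univ.filter fun e : Sym2 (Fin n) => w e ≠ 0) :=
        Finset.mem_filter.2 ⟨Finset.mem_univ _, hv₀⟩
      have := Finset.mem_filter.1 (hsub hmem)
      apply this.2
      simp only [hu, mem_setOf_eq, Sym2.mem_iff, true_or, not_true_eq_false, if_false]
  set ν := prodBernoulli u with hν
  haveI : IsProbabilityMeasure ν := inferInstance
  have hfilt : ∀ (x : Fin n) (ξ : BondConfig (Fin n)),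
      (A.filter fun z => (openGraph ξ).Reachable x z) = (A.filter fun z => ξ ∈ openConn x z) :=
    fun x ξ => Finset.filter_congr fun _ _ => Iff.rfl
  have eoc : ∀ (x : Fin n), {ξ : BondConfig (Fin n) | (A.filter fun z => (openGraph ξ).Reachable x z).card ≤ j} =
      {ξ : BondConfig (Fin n) | (A.filter fun z => ξ ∈ openConn x z).card ≤ j} := by
    intro x; ext ξ
    exact ⟨fun h => by rw [mem_setOf_eq] at h ⊢; rwa [← hfilt x ξ], fun h => by rw [mem_setOf_eq] at h ⊢; rwa [hfilt x ξ]⟩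
  set sW : Fin n → ℝ := fun v => ν.real {ξ : BondConfig (Fin n) | (A.filter fun z => (openGraph ξ).Reachable v z).card ≤ j} with hsW
  -- ### the glued star packing with the starwise references
  rw [← hBeq]
  refine gluedSet_lsp_of_starwise w A B' y q c r j hyA hrA hqA hcA hyB' ?_ (by rw [hBeq]; exact hsum)
  -- ### the packing inequality at every star
  intro S hS
  set S' : Finset (Fin n) := B' ∪ S with hS'
  set x : Fin n := r S with hx
  have hxA : x ∈ A := hrA S
  have eP1 : {ω : BondConfig (Fin n) | (∀ m ∈ S', ¬ (openGraph (ω ∩ {e | y ∉ e})).Reachable x m) ∧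
        1 ≤ (A.filter fun z => ∃ m ∈ S', (openGraph (ω ∩ {e | y ∉ e})).Reachable m z).card ∧
        (A.filter fun z => ∃ m ∈ S', (openGraph (ω ∩ {e | y ∉ e})).Reachable m z).card ≤ j} =
      {ω : BondConfig (Fin n) | ω ∩ {e | y ∉ e} ∈ {ξ : BondConfig (Fin n) | (∀ m ∈ S', ¬ (openGraph ξ).Reachable x m) ∧
        1 ≤ (A.filter fun z => ∃ m ∈ S', (openGraph ξ).Reachable m z).card ∧
        (A.filter fun z => ∃ m ∈ S', (openGraph ξ).Reachable m z).card ≤ j}} := rfl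
  have eP2 : {ω : BondConfig (Fin n) | ¬ 1 ≤ (A.filter fun z => ∃ m ∈ S', (openGraph (ω ∩ {e | y ∉ e})).Reachable m z).card ∧
        (A.filter fun z => (openGraph (ω ∩ {e | y ∉ e})).Reachable c z).card ≤ j} =
      {ω : BondConfig (Fin n) | ω ∩ {e | y ∉ e} ∈ {ξ : BondConfig (Fin n) |
        ¬ 1 ≤ (A.filter fun z => ∃ m ∈ S', (openGraph ξ).Reachable m z).card ∧ (A.filter fun z => (openGraph ξ).Reachable c z).card ≤ j}} := rfl
  have eP3 : {ω : BondConfig (Fin n) | (∀ m ∈ S', ¬ (openGraph (ω ∩ {e | y ∉ e})).Reachable x m) ∧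
        (A.filter fun z => (openGraph (ω ∩ {e | y ∉ e})).Reachable x z).card ≤ j} =
      {ω : BondConfig (Fin n) | ω ∩ {e | y ∉ e} ∈ {ξ : BondConfig (Fin n) | (∀ m ∈ S', ¬ (openGraph ξ).Reachable x m) ∧
        (A.filter fun z => (openGraph ξ).Reachable x z).card ≤ j}} := rfl
  rw [eP1, eP2, eP3, measureReal_preimage_avoid, measureReal_preimage_avoid, measureReal_preimage_avoid]
  set MS : BondConfig (Fin n) → ℕ := fun ξ => (A.filter fun z => ∃ m ∈ S', (openGraph ξ).Reachable m z).card with hMS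
  set Lx : Fin n → BondConfig (Fin n) → ℕ := fun v ξ => (A.filter fun z => (openGraph ξ).Reachable v z).card with hLx
  change ν.real {ξ | (∀ m ∈ S', ¬ (openGraph ξ).Reachable x m) ∧ 1 ≤ MS ξ ∧ MS ξ ≤ j} + ν.real {ξ | ¬ 1 ≤ MS ξ ∧ Lx c ξ ≤ j} ≤
    ν.real {ξ | (∀ m ∈ S', ¬ (openGraph ξ).Reachable x m) ∧ Lx x ξ ≤ j}
  have hMS0 : ∀ ξ, ¬ 1 ≤ MS ξ → ∀ m ∈ S', ¬ (openGraph ξ).Reachable x m := by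
    intro ξ h m hm hxm
    exact h (Finset.card_pos.2 ⟨x, Finset.mem_filter.2 ⟨hxA, m, hm, hxm.symm⟩⟩)
  -- stability from a member no `u`-lighter than `x` (used twice)
  have hstab : ∀ m ∈ S', x ≠ m → sW m ≤ sW x →
      ν.real {ξ | (∀ m ∈ S', ¬ (openGraph ξ).Reachable x m) ∧ 1 ≤ MS ξ ∧ MS ξ ≤ j} + ν.real {ξ | ¬ 1 ≤ MS ξ ∧ Lx c ξ ≤ j} ≤
        ν.real {ξ | (∀ m ∈ S', ¬ (openGraph ξ).Reachable x m) ∧ Lx x ξ ≤ j} := by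
    intro m hmS hxm hm
    have key := unguardedStability_of_member u A S' hmS hxm j hm
    change ν.real {ξ | (∀ m ∈ S', ¬ (openGraph ξ).Reachable x m) ∧ MS ξ ≤ j} ≤
      ν.real {ξ | (∀ m ∈ S', ¬ (openGraph ξ).Reachable x m) ∧ Lx x ξ ≤ j} at key
    have hdisj : Disjoint {ξ | (∀ m ∈ S', ¬ (openGraph ξ).Reachable x m) ∧ 1 ≤ MS ξ ∧ MS ξ ≤ j} {ξ | ¬ 1 ≤ MS ξ ∧ Lx c ξ ≤ j} := by
      rw [Set.disjoint_left]
      rintro ξ ⟨_, h1, _⟩ ⟨h2, _⟩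
      exact h2 h1
    have hsub : {ξ | (∀ m ∈ S', ¬ (openGraph ξ).Reachable x m) ∧ 1 ≤ MS ξ ∧ MS ξ ≤ j} ∪ {ξ | ¬ 1 ≤ MS ξ ∧ Lx c ξ ≤ j} ⊆
        {ξ | (∀ m ∈ S', ¬ (openGraph ξ).Reachable x m) ∧ MS ξ ≤ j} := by
      rintro ξ (⟨h1, _, h3⟩ | ⟨h1, _⟩)
      · exact ⟨h1, h3⟩
      · exact ⟨hMS0 ξ h1, by show MS ξ ≤ j; omega⟩
    have hu' := measureReal_union hdisj (MeasurableSet.of_discrete (s := {ξ | ¬ 1 ≤ MS ξ ∧ Lx c ξ ≤ j})) (μ := ν)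
      (measure_ne_top _ _) (measure_ne_top _ _)
    rw [← hu']
    exact (measureReal_mono hsub (measure_ne_top _ _)).trans key
  by_cases hpS : x ∈ S'
  · -- the reference is a member: everything vanishes
    have h1 : ν.real {ξ | (∀ m ∈ S', ¬ (openGraph ξ).Reachable x m) ∧ 1 ≤ MS ξ ∧ MS ξ ≤ j} = 0 := by
      have : {ξ | (∀ m ∈ S', ¬ (openGraph ξ).Reachable x m) ∧ 1 ≤ MS ξ ∧ MS ξ ≤ j} = (∅ : Set (BondConfig (Fin n))) := by
        ext ξ; simp only [mem_setOf_eq, mem_empty_iff_false, iff_false, not_and]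
        intro h; exact absurd (SimpleGraph.Reachable.refl x) (h x hpS)
      rw [this, measureReal_empty]
    have h2 : ν.real {ξ | ¬ 1 ≤ MS ξ ∧ Lx c ξ ≤ j} = 0 := by
      have : {ξ | ¬ 1 ≤ MS ξ ∧ Lx c ξ ≤ j} = (∅ : Set (BondConfig (Fin n))) := by
        ext ξ; simp only [mem_setOf_eq, mem_empty_iff_false, iff_false, not_and]
        intro h; exact absurd (SimpleGraph.Reachable.refl x) (hMS0 ξ h x hpS)
      rw [this, measureReal_empty]
    rw [h1, h2, add_zero]; exact measureReal_nonneg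
  rcases hadm S hS with hch | ⟨m, hmS, hxm, hm⟩
  · -- #### the reference is a champion of `u`
    have hpmax : ∀ a ∈ A, sW a ≤ sW x := by
      intro a ha; simp only [hsW]; rw [eoc a, eoc x]; exact hch a ha
    by_cases hdm : ∃ m ∈ S', sW m ≤ sW x
    · obtain ⟨m, hmS, hm⟩ := hdm
      exact hstab m hmS (fun h => hpS (h ▸ hmS)) hm
    · push Not at hdm
      have hS'A : ∀ m ∈ S', m ∉ A := by
        intro m hm hmA
        exact absurd (hpmax m hmA) (not_le.2 (hdm m hm))
      have hS'ne : S'.Nonempty := by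
        obtain ⟨m, hm⟩ := hB'ne; exact ⟨m, Finset.mem_union_left _ hm⟩
      have hIH := ih n u A S' x c j hlt hxA hcA hS'ne hS'A hch
      have hfiltS : ∀ (ξ : BondConfig (Fin n)),
          (A.filter fun z => ∃ m ∈ S', (openGraph ξ).Reachable m z) = (A.filter fun z => ∃ m ∈ S', ξ ∈ openConn m z) :=
        fun ξ => Finset.filter_congr fun _ _ => Iff.rfl
      have eL : {ξ : BondConfig (Fin n) | (∀ m ∈ S', ξ ∉ openConn x m) ∧ 1 ≤ (A.filter fun z => ∃ m ∈ S', ξ ∈ openConn m z).card ∧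
            (A.filter fun z => ∃ m ∈ S', ξ ∈ openConn m z).card ≤ j} = {ξ | (∀ m ∈ S', ¬ (openGraph ξ).Reachable x m) ∧ 1 ≤ MS ξ ∧ MS ξ ≤ j} := by
        ext ξ; simp only [mem_setOf_eq, hMS, hfiltS ξ]; exact Iff.rfl
      have eZ : {ξ : BondConfig (Fin n) | ¬ 1 ≤ (A.filter fun z => ∃ m ∈ S', ξ ∈ openConn m z).card ∧
            (A.filter fun z => ξ ∈ openConn c z).card ≤ j} = {ξ | ¬ 1 ≤ MS ξ ∧ Lx c ξ ≤ j} := by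
        ext ξ; simp only [mem_setOf_eq, hMS, hLx, hfiltS ξ, hfilt c ξ]
      have eR : {ξ : BondConfig (Fin n) | (∀ m ∈ S', ξ ∉ openConn x m) ∧ (A.filter fun z => ξ ∈ openConn x z).card ≤ j} =
          {ξ | (∀ m ∈ S', ¬ (openGraph ξ).Reachable x m) ∧ Lx x ξ ≤ j} := by
        ext ξ; simp only [mem_setOf_eq, hLx, hfilt x ξ]; exact Iff.rfl
      rw [eL, eZ, eR] at hIH
      exact hIH
  · -- #### the reference dominates a member of the glued star
    have hm' : sW m ≤ sW x := by simp only [hsW]; rw [eoc m, eoc x]; exact hm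
    exact hstab m hmS hxm.symm hm'


/-- **The crux from the REF certificate at core gluing instances.**  `NoHeavyLowerTail` follows if every CORE gluing instance (champion `q`,
light non-relay `B` with `2 ≤ |B|`, every member with a positive pair, gluing `B` dethrones `q`, `q` a champion of no `w − y`, `q` with no
pair to `B`, the set-induction hypothesis) admits a member `y` and a starwise reference `r` (each `r S` a champion of `u_y` or no heavier in
`u_y` than some member of `(B ∖ y) ∪ S`) with `Σ_S μ(G_{r S} ∩ σ_S) ≤ μ(G_q)`. [cite: KozmaNitzan2024, Lemma 5 and Thm. 4 (pp. 13–14)] -/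
theorem noHeavyLowerTail_of_refCertificate
    (hRef : ∀ (n : ℕ) (w : Sym2 (Fin n) → unitInterval) (A B : Finset (Fin n)) (q c : Fin n) (j : ℕ),
      (∀ (n' : ℕ) (w' : Sym2 (Fin n') → unitInterval) (A' B' : Finset (Fin n')) (q' c' : Fin n') (j' : ℕ),
        (Finset.univ.filter fun e : Sym2 (Fin n') => w' e ≠ 0).card < (Finset.univ.filter fun e : Sym2 (Fin n) => w e ≠ 0).card →
        q' ∈ A' → c' ∈ A' → B'.Nonempty → (∀ m ∈ B', m ∉ A') →
        (∀ a ∈ A', (prodBernoulli w').real {ω : BondConfig (Fin n') | (A'.filter fun x => ω ∈ openConn a x).card ≤ j'} ≤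
          (prodBernoulli w').real {ω : BondConfig (Fin n') | (A'.filter fun x => ω ∈ openConn q' x).card ≤ j'}) →
        (prodBernoulli w').real {ω : BondConfig (Fin n') | (∀ m ∈ B', ω ∉ openConn q' m) ∧
            1 ≤ (A'.filter fun z => ∃ m ∈ B', ω ∈ openConn m z).card ∧ (A'.filter fun z => ∃ m ∈ B', ω ∈ openConn m z).card ≤ j'} +
          (prodBernoulli w').real {ω : BondConfig (Fin n') | ¬ 1 ≤ (A'.filter fun z => ∃ m ∈ B', ω ∈ openConn m z).card ∧
            (A'.filter fun z => ω ∈ openConn c' z).card ≤ j'} ≤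
        (prodBernoulli w').real {ω : BondConfig (Fin n') | (∀ m ∈ B', ω ∉ openConn q' m) ∧ (A'.filter fun z => ω ∈ openConn q' z).card ≤ j'}) →
      q ∈ A → c ∈ A → 2 ≤ B.card → (∀ y ∈ B, y ∉ A) →
      (∀ a ∈ A, (prodBernoulli w).real {ω : BondConfig (Fin n) | (A.filter fun x => ω ∈ openConn a x).card ≤ j} ≤
        (prodBernoulli w).real {ω : BondConfig (Fin n) | (A.filter fun x => ω ∈ openConn q x).card ≤ j}) →
      (∀ y ∈ B, (prodBernoulli w).real {ω : BondConfig (Fin n) | (A.filter fun x => ω ∈ openConn q x).card ≤ j} <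
        (prodBernoulli w).real {ω : BondConfig (Fin n) | (A.filter fun x => ω ∈ openConn y x).card ≤ j}) →
      (∀ y ∈ B, ∃ v, v ≠ y ∧ w s(y, v) ≠ 0) →
      (∃ a ∈ A, (prodBernoulli w).real {ω : BondConfig (Fin n) |
          ((∃ m ∈ B, ω ∈ openConn q m) → (A.filter fun z => ∃ m ∈ B, ω ∈ openConn m z).card ≤ j) ∧
            ((∀ m ∈ B, ω ∉ openConn q m) → (A.filter fun z => ω ∈ openConn q z).card ≤ j)} <
        (prodBernoulli w).real {ω : BondConfig (Fin n) |
          ((∃ m ∈ B, ω ∈ openConn a m) → (A.filter fun z => ∃ m ∈ B, ω ∈ openConn m z).card ≤ j) ∧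
            ((∀ m ∈ B, ω ∉ openConn a m) → (A.filter fun z => ω ∈ openConn a z).card ≤ j)}) →
      (∀ y ∈ B, ∃ a ∈ A, (prodBernoulli fun e => if e ∈ {e : Sym2 (Fin n) | y ∉ e} then w e else 0).real
            {ξ : BondConfig (Fin n) | (A.filter fun z => ξ ∈ openConn q z).card ≤ j} <
          (prodBernoulli fun e => if e ∈ {e : Sym2 (Fin n) | y ∉ e} then w e else 0).real
            {ξ : BondConfig (Fin n) | (A.filter fun z => ξ ∈ openConn a z).card ≤ j}) →
      (∀ y ∈ B, w s(q, y) = 0) →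
      ∃ y ∈ B, ∃ r : Finset (Fin n) → Fin n, (∀ S, r S ∈ A) ∧
        (∀ S : Finset (Fin n), (∀ v ∈ S, v ≠ y ∧ w s(y, v) ≠ 0) →
          (∀ a ∈ A, (prodBernoulli fun e => if e ∈ {e : Sym2 (Fin n) | y ∉ e} then w e else 0).real
              {ξ : BondConfig (Fin n) | (A.filter fun z => ξ ∈ openConn a z).card ≤ j} ≤
            (prodBernoulli fun e => if e ∈ {e : Sym2 (Fin n) | y ∉ e} then w e else 0).real
              {ξ : BondConfig (Fin n) | (A.filter fun z => ξ ∈ openConn (r S) z).card ≤ j}) ∨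
          (∃ m ∈ B.erase y ∪ S, m ≠ r S ∧
            (prodBernoulli fun e => if e ∈ {e : Sym2 (Fin n) | y ∉ e} then w e else 0).real
                {ξ : BondConfig (Fin n) | (A.filter fun z => ξ ∈ openConn m z).card ≤ j} ≤
              (prodBernoulli fun e => if e ∈ {e : Sym2 (Fin n) | y ∉ e} then w e else 0).real
                {ξ : BondConfig (Fin n) | (A.filter fun z => ξ ∈ openConn (r S) z).card ≤ j})) ∧
        (∑ S ∈ (Finset.univ.filter fun v => v ≠ y ∧ w s(y, v) ≠ 0).powerset, (prodBernoulli w).real ({ω : BondConfig (Fin n) |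
            ((∃ m ∈ B, ω ∈ openConn (r S) m) → (A.filter fun z => ∃ m ∈ B, ω ∈ openConn m z).card ≤ j) ∧
              ((∀ m ∈ B, ω ∉ openConn (r S) m) → (A.filter fun z => ω ∈ openConn (r S) z).card ≤ j)} ∩ starEvent y ↑S) ≤
          (prodBernoulli w).real {ω : BondConfig (Fin n) |
            ((∃ m ∈ B, ω ∈ openConn q m) → (A.filter fun z => ∃ m ∈ B, ω ∈ openConn m z).card ≤ j) ∧
              ((∀ m ∈ B, ω ∉ openConn q m) → (A.filter fun z => ω ∈ openConn q z).card ≤ j)})) :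
    Summit.CriticalPhenomena.PercolationContinuityZ3.Theses.PercNearOneGluing.NoHeavyLowerTail := by
  refine noHeavyLowerTail_of_coreGluedChampion fun n w A B q c j ih hq hc hB hBA hch hl hall hinf hdd hnadj => ?_
  obtain ⟨y, hyB, r, hrA, hadm, hsum⟩ := hRef n w A B q c j ih hq hc hB hBA hch hl hall hinf hdd hnadj
  exact gluedSet_lsp_of_starwiseRefs w A B y q c r j ih hq hc hBA hyB hB (hall y hyB) hrA hadm hsum

end Summit.CriticalPhenomena.PercolationContinuityZ3.Theorems

end
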